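/-
Origin: expansion seat `planner-pub-hodgecm-pv11-g4-0`, handover #1 2026-08-18T06:51:42Z (`HOME/pub-hodgecm-pv11-g4/lean/Pv11g4/NormOneRelTorus.lean`, md5 bafc96bc, 423 lines);
landed by the gen-7 packager in gate run 25 as `HodgeCM/PerL34/NormOneRelTorus.lean` (verbatim).
-/
/-
Origin: expansion seat `planner-pub-hodgecm-pv11-g4-0` (unit `pub-hodgecm-pv11-g4`, DAG-NODE PROVER #11 gen 4), HodgeCM publication
cell, 2026-08-18.  WIP module `Pv11g4.NormOneRelTorus`; intended landing `HodgeCM/PerL34/NormOneRelTorus.lean` (no import rewrite needed: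
imports are landed tree modules only).
-/
import Summits.HodgeConjecture.HodgeCM.PerL34.NormOneCompactCriterion
import Summits.HodgeConjecture.HodgeCM.PerL34.PrincipalIdelesDiscrete
import Summits.HodgeConjecture.HodgeCM.Literature.NormOneCompactHolds
import Literature.NumberTheory.Automorphic.ClassFieldCharacter
import Mathlib.MeasureTheory.Measure.Haar.Basic
import Mathlib.NumberTheory.NumberField.CMField

/-!
# The relative norm-one idele torus `U(1)_{L/K}(𝔸_K)` and its compact automorphic quotient (route (E), N17 / S5)

PerL v5 §3.2, tex l. 264 integrates the theta kernel over `[U(W_j)] = U(W_j)(L₀) \ U(W_j)(𝔸_{L₀})`, where for a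
hermitian LINE `W_j` over the CM extension `L/L₀` one has `U(W_j) = U(1)_{L/L₀} = ker (N_{L/L₀} : Res_{L/L₀} 𝔾_m → 𝔾_m)`,
so `U(W_j)(𝔸_{L₀}) = {y ∈ 𝔸_L^× : y · ȳ = 1}` and `U(W_j)(L₀) = L^1 = {ℓ ∈ L^× : ℓ ℓ̄ = 1}`.  The route-(E) bridge record
`HodgeCM.PerL34.SupplyAdelic.SupplyBridgeA` (pv11-g3) carries this group abstractly (`DS.A₁`, `rat`) together with the
instance fields `instA instT instTG instT2` (SETUP), **`instD : DiscreteTopology rat`** (PRINT: Cassels–Fröhlich II §14 +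
X intro) and **`instQ : CompactSpace (DS.A₁ ⧸ rat)`** (PRINT: Godement, Sém. Bourbaki 257, Thm 2 (Ono) / Thm 4
(Borel–Harish-Chandra)), and the measure fields `instM instB ν instF instO instR` (SETUP, "`du`").

This file CONSTRUCTS the genuine objects over Mathlib's adele ring and PROVES every one of those fields for them, for an
arbitrary extension of number fields `K → L` (the application is `K = L⁺ = maximalRealSubfield L` of a CM field `L`):

* `NumberField.relNormOneIdeles K L : Subgroup (ideleGroup L)` — `U(1)_{L/K}(𝔸_K) := ker N`, `N y = ∏_{σ ∈ Aut(L/K)} σ • y`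
  the Galois norm on ideles (vendored tree `AdeleRing.ideleGalNorm`, Cassels–Fröhlich II §11 / VII §1–2), a CLOSED subgroup;
* `NumberField.relNormOneRat K L : Subgroup (relNormOneIdeles K L)` — the rational points `L^1 = ker N ∩ L^×`
  (`(principalIdeles L).subgroupOf _`);
* `NumberField.ideleNorm_galSmul` — **Galois invariance of the idele norm** `|σ • y|_L = |y|_L` (reindex the product of
  local norms along `w ↦ σ • w`; local isometries `‖σ y‖_{σ w} = ‖y‖_w` from the vendored tree), whence
  `|N y| = |y| ^ #Aut(L/K)` and **`ker N ≤ J¹_L`** (`relNormOneIdeles_le_normOneIdeles`);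
* **`DiscreteTopology (relNormOneRat K L)`** (= field `instD`), from pv10's KERNEL `instDiscreteTopologyPrincipalIdeles`
  (Neukirch VI (1.5));
* **`CompactSpace (relNormOneIdeles K L ⧸ relNormOneRat K L)`** (= field `instQ`): from the KERNEL compactness of `C¹_L`
  (`normOneIdeleClassesCompact_holds`, cf-hasseminkowski-g5, discharging Cassels–Fröhlich II §16 THEOREM from the vendored
  tree) in Cassels' cover form (`normOneIdeleCompactCover_of_compact`, pv10) by a FINITE-REPRESENTATIVES argument:
  if `W` is a compact set of ideles meeting every norm-one principal coset, then `F := N(W) ∩ L^×` is finite (compact ∩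
  discrete-closed), and choosing for each `m ∈ F ∩ N(L^×)` one `k_m ∈ L^×` with `N k_m = m` gives
  `ker N = (ker N ∩ ⋃_{m ∈ F} W k_m⁻¹) · L^1` — so `[U(1)]` is the continuous image of a compact set.  (No Hasse norm
  theorem, no Hilbert 90, no reduction theory is used.)
* the remaining instance fields (`CommGroup`, `IsTopologicalGroup`, `T2Space`, `LocallyCompactSpace`, `T2Space` of the
  quotient, Borel σ-algebra, the Haar measure `ν := haar` finite / open-positive / right-invariant) and the packaging
  `NumberField.AutomorphicTorusDatum` / `NumberField.relNormOneTorusDatum K L` (resp. `unitaryLineTorusDatum L` for a CM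
  field) whose fields are, name for name, the group/measure fields of `SupplyBridgeA`.

Consequently, in the route-(E) dictionary of `SupplyAdelic.lean` the labels of `instD`, `instQ` change from PRINT to
KERNEL and `instA … instR`, `rat`, `ν` from SETUP to CONSTRUCTED whenever `DS.A₁` is taken to be the genuine
`U(W_j)(𝔸) = relNormOneIdeles L⁺ L` (what is NOT supplied here is the Weil-representation part of `DS`, fields
`S₁, ω₁, ev₁, …` — GAPS.md pv11g3-A1 / carverg2-X1 — which stays DICTIONARY).

Inputs: tree modules only (pv10 `IdeleNorm` / `NormOneCompactCriterion` / `PrincipalIdelesDiscrete` / `ResidueFieldsFinite`,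
cf-hasseminkowski-g5 `Literature.NormOneCompactHolds`, the vendored H21 cone `GaloisActionPlaces` / `GaloisActionAdeleRing` /
`ClassFieldCharacter` of gate run 24) and Mathlib.  No PerL / QW8 / 2001-programme statement is used; no named fact, no
hypothesis beyond the displayed ones; every declaration below is proved.

References (for the statements being made kernel; nothing is cited as a hypothesis):
* J. W. S. Cassels, A. Fröhlich (eds.), *Algebraic Number Theory* (1967), Ch. II (Cassels) §14 (discreteness of `k` in
  `V_k`), §16 THEOREM p. 121 (`J¹/k^×` compact); Ch. VII (Tate) §1.1 (Galois action on places and completions).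
  [held `book:editornd-algebraic-number-theory`]
* R. Godement, *Domaines fondamentaux des groupes arithmétiques*, Sém. Bourbaki 257 (1962/63), § 3 Thm 2 (Ono), § 5 Thm 4
  (Borel–Harish-Chandra): `G_A°/G_k` compact for anisotropic `G` — here re-proved directly for the torus `U(1)_{L/K}`.
-/

set_option autoImplicit false

noncomputable section

open Topology Filter Set Function MeasureTheory
open scoped Pointwise NNReal

namespace NumberField

open IsDedekindDomain
open Literature.NumberTheory Literature.NumberTheory.Automorphic

/-! ## § 1. Galois invariance of the idele norm -/

section GaloisNorm

variable {K L : Type} [Field K] [Field L] [NumberField L] [Algebra K L]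

/-- Base-congruence for `WithZeroMulInt.toNNReal` (the base is determined by a proof argument). -/
private theorem toNNReal_congr_base {e e' : ℝ≥0} (he : e ≠ 0) (he' : e' ≠ 0) (h : e = e')
    (x : WithZero (Multiplicative ℤ)) :
    WithZeroMulInt.toNNReal he x = WithZeroMulInt.toNNReal he' x := by
  subst h; rfl

/-- **Local isometry at the finite places**: `‖σ y‖_{σ w} = ‖y‖_w` for the transport `L_w → L_{σ w}` (the valuation is
preserved, vendored `valued_galAdicCompletionMap`, and conjugate primes have the same residue cardinality,
`HeightOneSpectrum.absNorm_algEquiv_smul`). -/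
theorem norm_galAdicCompletionMap (σ : L ≃ₐ[K] L) {w w' : HeightOneSpectrum (𝓞 L)} (h : σ • w = w')
    (y : w.adicCompletion L) : ‖galAdicCompletionMap σ h y‖ = ‖y‖ := by
  subst h
  rw [FinitePlace.norm_def, FinitePlace.norm_def, valued_galAdicCompletionMap]
  congr 1
  refine toNNReal_congr_base _ _ ?_ _
  rw [Literature.NumberTheory.Automorphic.HeightOneSpectrum.absNorm_algEquiv_smul]

/-- Components of a conjugated idele at the finite places: `‖(σ • x)_v‖_v = ‖x_{σ⁻¹ v}‖_{σ⁻¹ v}`. -/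
theorem norm_finComp_galSmul (σ : L ≃ₐ[K] L) (x : ideleGroup L) (v : HeightOneSpectrum (𝓞 L)) :
    ‖finComp L (σ • x) v‖ = ‖finComp L x (σ⁻¹ • v)‖ := by
  simp only [finComp, AdeleRing.coe_smul_units, AdeleRing.smul_snd, FiniteAdeleRing.smul_apply]
  exact norm_galAdicCompletionMap σ _ _

/-- The finite part of the idele norm is `Aut(L/K)`-invariant. -/
theorem finIdeleNorm_galSmul (σ : L ≃ₐ[K] L) (x : ideleGroup L) :
    finIdeleNorm L (σ • x) = finIdeleNorm L x := by
  rw [finIdeleNorm_apply, finIdeleNorm_apply]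
  simp_rw [norm_finComp_galSmul σ x]
  exact finprod_eq_of_bijective (fun v => σ⁻¹ • v) (MulAction.bijective σ⁻¹) fun _ => rfl

/-- The archimedean norm `‖x‖ = ∏_w ‖x_w‖^{mult w}` on `L_∞` is `Aut(L/K)`-invariant (reindex along `w ↦ σ • w`;
`‖(σ • x)_{σ w}‖ = ‖x_w‖` and `mult (σ • w) = mult w`). -/
theorem InfiniteAdeleRing.norm_galSmul (σ : L ≃ₐ[K] L) (x : InfiniteAdeleRing L) : ‖σ • x‖ = ‖x‖ := by
  rw [InfiniteAdeleRing.norm_def, InfiniteAdeleRing.norm_def]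
  refine (Fintype.prod_equiv (MulAction.toPerm σ) (fun w => ‖x w‖ ^ w.mult)
    (fun w => ‖(σ • x) w‖ ^ w.mult) fun w => ?_).symm
  rw [MulAction.toPerm_apply, Literature.NumberTheory.Automorphic.InfiniteAdeleRing.norm_smul_apply_smul]
  unfold InfinitePlace.mult
  rw [InfinitePlace.isReal_smul_iff]

/-- **Galois invariance of the idele norm**: `|σ • x|_L = |x|_L` for `σ ∈ Aut(L/K)`. -/
theorem ideleNorm_galSmul (σ : L ≃ₐ[K] L) (x : ideleGroup L) : ideleNorm L (σ • x) = ideleNorm L x := by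
  change ‖(((σ • x : ideleGroup L) : AdeleRing (𝓞 L) L)).1‖ * finIdeleNorm L (σ • x) =
    ‖((x : AdeleRing (𝓞 L) L)).1‖ * finIdeleNorm L x
  rw [finIdeleNorm_galSmul, AdeleRing.coe_smul_units, AdeleRing.smul_fst, InfiniteAdeleRing.norm_galSmul]

/-- Conjugation `y ↦ σ • y` is continuous on the idele group (units topology). -/
theorem continuous_galSmul_idele (σ : L ≃ₐ[K] L) : Continuous fun x : ideleGroup L => σ • x := by
  refine Units.continuous_iff.mpr ⟨?_, ?_⟩
  · exact (continuous_const_smul σ).comp Units.continuous_val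
  · exact (continuous_const_smul σ).comp Units.continuous_coe_inv

/-- A conjugate of a principal idele is principal: `σ • (ℓ) = (σ ℓ)`. -/
theorem galSmul_mem_principalIdeles (σ : L ≃ₐ[K] L) {k : ideleGroup L} (hk : k ∈ principalIdeles L) :
    σ • k ∈ principalIdeles L := by
  obtain ⟨ℓ, rfl⟩ := hk
  refine ⟨Units.map ((σ : L ≃ₐ[K] L) : L →+* L).toMonoidHom ℓ, Units.ext ?_⟩
  change algebraMap L (AdeleRing (𝓞 L) L) (σ (ℓ : L)) = σ • algebraMap L (AdeleRing (𝓞 L) L) (ℓ : L)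
  rw [AdeleRing.smul_algebraMap]

end GaloisNorm

/-! ## § 2. The torus `U(1)_{L/K}(𝔸_K) = ker N` and its rational points `L^1` -/

section Torus

variable (K L : Type) [Field K] [Field L] [NumberField L] [Algebra K L] [FiniteDimensional K L]

/-- **`U(1)_{L/K}(𝔸_K)`**: the ideles of `L` of relative norm one, `ker (N : 𝔸_L^× → 𝔸_L^×)`, `N y = ∏_{σ ∈ Aut(L/K)} σ • y`
(for `L/K` quadratic, `N y = y · ȳ`).  This is `U(W_j)(𝔸)` of PerL l. 264 for a hermitian line `W_j` over `L/K`. -/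
def relNormOneIdeles : Subgroup (ideleGroup L) := (AdeleRing.ideleGalNorm K L).ker

/-- (Ported verbatim from the HodgeCMPerL package; no docstring in the source.) -/
theorem mem_relNormOneIdeles_iff (y : ideleGroup L) :
    y ∈ relNormOneIdeles K L ↔ AdeleRing.ideleGalNorm K L y = 1 := Iff.rfl

/-- (Ported verbatim from the HodgeCMPerL package; no docstring in the source.) -/
theorem mem_relNormOneIdeles_iff_prod (y : ideleGroup L) :
    y ∈ relNormOneIdeles K L ↔ ∏ σ : L ≃ₐ[K] L, σ • y = 1 := Iff.rfl

/-- The Galois norm on ideles is continuous. -/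
theorem continuous_ideleGalNorm : Continuous (AdeleRing.ideleGalNorm K L) := by
  have : ⇑(AdeleRing.ideleGalNorm K L) = fun y => ∏ σ : L ≃ₐ[K] L, σ • y :=
    funext fun y => AdeleRing.ideleGalNorm_apply K L y
  rw [this]
  exact continuous_finsetProd _ fun σ _ => continuous_galSmul_idele σ

/-- `U(1)_{L/K}(𝔸_K)` is closed in `𝔸_L^×`. -/
theorem isClosed_relNormOneIdeles : IsClosed (relNormOneIdeles K L : Set (ideleGroup L)) := by
  rw [relNormOneIdeles, MonoidHom.coe_ker]
  exact isClosed_singleton.preimage (continuous_ideleGalNorm K L)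

/-- `|N y|_L = |y|_L ^ #Aut(L/K)`. -/
theorem ideleNorm_ideleGalNorm (y : ideleGroup L) :
    ideleNorm L (AdeleRing.ideleGalNorm K L y) = ideleNorm L y ^ Fintype.card (L ≃ₐ[K] L) := by
  rw [AdeleRing.ideleGalNorm_apply, map_prod]
  simp_rw [ideleNorm_galSmul]
  rw [Finset.prod_const, Finset.card_univ]

/-- **`U(1)_{L/K}(𝔸_K) ≤ J¹_L`**: a relative-norm-one idele has idele norm one. -/
theorem relNormOneIdeles_le_normOneIdeles : relNormOneIdeles K L ≤ normOneIdeles L := by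
  intro y hy
  rw [mem_normOneIdeles_iff]
  have h := ideleNorm_ideleGalNorm K L y
  rw [(mem_relNormOneIdeles_iff K L y).mp hy, map_one] at h
  exact (pow_eq_one_iff_of_nonneg (ideleNorm_pos L y).le Fintype.card_ne_zero).mp h.symm

/-- The Galois norm of a principal idele is principal. -/
theorem ideleGalNorm_mem_principalIdeles {k : ideleGroup L} (hk : k ∈ principalIdeles L) :
    AdeleRing.ideleGalNorm K L k ∈ principalIdeles L := by
  rw [AdeleRing.ideleGalNorm_apply]
  exact Subgroup.prod_mem _ fun σ _ => galSmul_mem_principalIdeles σ hk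

/-- **`U(1)_{L/K}(K) = L^1`**: the rational points, i.e. the principal ideles of relative norm one, as a subgroup of
`U(1)_{L/K}(𝔸_K)`. -/
def relNormOneRat : Subgroup (relNormOneIdeles K L) := (principalIdeles L).subgroupOf (relNormOneIdeles K L)

/-- (Ported verbatim from the HodgeCMPerL package; no docstring in the source.) -/
theorem mem_relNormOneRat_iff (a : relNormOneIdeles K L) :
    a ∈ relNormOneRat K L ↔ (a : ideleGroup L) ∈ principalIdeles L := Iff.rfl

/-- The Galois norm of the principal idele `(ℓ)` is the principal idele `(N_{L/K} ℓ)` (`L/K` Galois;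
`Algebra.norm_eq_prod_automorphisms`). -/
theorem coe_ideleGalNorm_principal [IsGalois K L] (ℓ : Lˣ) :
    ((AdeleRing.ideleGalNorm K L (Units.map (algebraMap L (AdeleRing (𝓞 L) L) : L →* AdeleRing (𝓞 L) L) ℓ) :
        ideleGroup L) : AdeleRing (𝓞 L) L) =
      algebraMap L (AdeleRing (𝓞 L) L) (algebraMap K L (Algebra.norm K (ℓ : L))) := by
  rw [AdeleRing.ideleGalNorm_apply, Units.coe_prod, Algebra.norm_eq_prod_automorphisms K, map_prod]
  refine Finset.prod_congr rfl fun σ _ => ?_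
  rw [AdeleRing.coe_smul_units, Units.coe_map, MonoidHom.coe_coe, AdeleRing.smul_algebraMap]

/-- **`U(1)_{L/K}(K) = ker (N_{L/K} : L^× → K^×)`**: for `L/K` Galois, the principal idele `(ℓ)` lies in the torus iff
`N_{L/K}(ℓ) = 1` — so `relNormOneRat K L` is the group `L^1` of PerL l. 264 (`U(W_j)(L₀)` for a hermitian line). -/
theorem principal_mem_relNormOneIdeles_iff [IsGalois K L] (ℓ : Lˣ) :
    Units.map (algebraMap L (AdeleRing (𝓞 L) L) : L →* AdeleRing (𝓞 L) L) ℓ ∈ relNormOneIdeles K L ↔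
      Algebra.norm K (ℓ : L) = 1 := by
  rw [mem_relNormOneIdeles_iff, ← Units.val_eq_one, coe_ideleGalNorm_principal,
    map_eq_one_iff _ (AdeleRing.algebraMap_injective (𝓞 L) L), map_eq_one_iff _ (algebraMap K L).injective]

/-! ### The instance fields `instA instT instTG instT2` of `SupplyBridgeA`, and local compactness -/

example : CommGroup (relNormOneIdeles K L) := inferInstance
example : TopologicalSpace (relNormOneIdeles K L) := inferInstance
example : IsTopologicalGroup (relNormOneIdeles K L) := inferInstance
example : T2Space (relNormOneIdeles K L) := inferInstance

/-- (Ported verbatim from the HodgeCMPerL package; no docstring in the source.) -/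
instance locallyCompactSpace_relNormOneIdeles : LocallyCompactSpace (relNormOneIdeles K L) :=
  (isClosed_relNormOneIdeles K L).isClosedEmbedding_subtypeVal.locallyCompactSpace

/-! ### `instD`: the rational points are discrete -/

/-- **`U(1)(K) = L^1` is a discrete subgroup of `U(1)(𝔸_K)`** (field `instD` of `SupplyBridgeA`, KERNEL): it injects
continuously into the discrete `L^× ≤ 𝔸_L^×` (pv10 `instDiscreteTopologyPrincipalIdeles`). -/
instance discreteTopology_relNormOneRat : DiscreteTopology (relNormOneRat K L) :=
  DiscreteTopology.of_continuous_injective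
    (f := fun a : relNormOneRat K L => (⟨((a : relNormOneIdeles K L) : ideleGroup L), a.2⟩ : principalIdeles L))
    ((continuous_subtype_val.comp continuous_subtype_val).subtype_mk _)
    fun a b h => by
      have h' := congrArg Subtype.val h
      dsimp only at h'
      exact Subtype.ext (Subtype.ext h')

/-- `L^1` is closed in `U(1)(𝔸_K)`. -/
instance isClosed_relNormOneRat : IsClosed (relNormOneRat K L : Set (relNormOneIdeles K L)) :=
  Subgroup.isClosed_of_discrete

/-- The automorphic quotient `[U(1)] = U(1)(K) \ U(1)(𝔸_K)` is Hausdorff. -/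
instance t2Space_relNormOneQuot : T2Space (relNormOneIdeles K L ⧸ relNormOneRat K L) := inferInstance

/-! ### `instQ`: the automorphic quotient `[U(1)_{L/K}]` is compact -/

/-- **`[U(1)_{L/K}] = L^1 \ U(1)(𝔸_K)` is compact** (field `instQ` of `SupplyBridgeA`, KERNEL; Godement–Ono / Borel–
Harish-Chandra for this anisotropic torus, proved here from the compactness of `C¹_L` by finite representatives). -/
instance compactSpace_relNormOneQuot : CompactSpace (relNormOneIdeles K L ⧸ relNormOneRat K L) := by
  classical
  -- the Galois norm, the torus, the principal ideles
  set N := AdeleRing.ideleGalNorm K L with hN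
  have hNc : Continuous N := continuous_ideleGalNorm K L
  -- Cassels' compact cover of the norm-one ideles (KERNEL: `C¹_L` is compact)
  obtain ⟨W, hWc, hW⟩ := normOneIdeleCompactCover_of_compact L (normOneIdeleClassesCompact_holds L)
  -- the finite set `F = N(W) ∩ L^×`
  set F : Set (ideleGroup L) := N '' W ∩ (principalIdeles L : Set (ideleGroup L)) with hF
  have hPd : IsDiscrete (principalIdeles L : Set (ideleGroup L)) :=
    SetLike.isDiscrete_iff_discreteTopology.mpr inferInstance
  have hFfin : F.Finite :=
    ((hWc.image hNc).inter_right (principalIdelesClosed L)).finite (hPd.mono inter_subset_right)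
  -- representatives `k_m ∈ L^×` with `N k_m = m` whenever `m` is a norm from `L^×`
  let rep : ideleGroup L → ideleGroup L := fun m =>
    if h : ∃ k ∈ principalIdeles L, N k = m then h.choose else 1
  have hrep_mem : ∀ m, rep m ∈ principalIdeles L := by
    intro m
    by_cases h : ∃ k ∈ principalIdeles L, N k = m
    · simp only [rep, dif_pos h]; exact h.choose_spec.1
    · simp only [rep, dif_neg h]; exact one_mem _
  have hrep_N : ∀ m, (∃ k ∈ principalIdeles L, N k = m) → N (rep m) = m := by
    intro m h
    simp only [rep, dif_pos h]
    exact h.choose_spec.2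
  -- the compact set `C = ⋃_{m ∈ F} W · k_m⁻¹`
  set C : Set (ideleGroup L) := ⋃ m ∈ F, (fun w => w * (rep m)⁻¹) '' W with hC
  have hCc : IsCompact C := hFfin.isCompact_biUnion fun m _ => hWc.image (continuous_mul_const _)
  -- its trace on the (closed) torus is compact
  have hCA : IsCompact ((Subtype.val : relNormOneIdeles K L → ideleGroup L) ⁻¹' C) :=
    (isClosed_relNormOneIdeles K L).isClosedEmbedding_subtypeVal.isCompact_preimage hCc
  -- and maps onto the quotient
  have himg : (QuotientGroup.mk : relNormOneIdeles K L → relNormOneIdeles K L ⧸ relNormOneRat K L) ''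
      ((Subtype.val : relNormOneIdeles K L → ideleGroup L) ⁻¹' C) = Set.univ := by
    refine Set.eq_univ_of_forall fun q => ?_
    induction q using QuotientGroup.induction_on with
    | H a =>
      have ha : (a : ideleGroup L) ∈ relNormOneIdeles K L := a.2
      have hNa : N a = 1 := (mem_relNormOneIdeles_iff K L a).mp ha
      -- `a ∈ J¹`, so `a k ∈ W` for some principal `k`
      obtain ⟨k, hk, hakW⟩ := hW a (relNormOneIdeles_le_normOneIdeles K L ha)
      -- `m := N k = N (a k) ∈ N(W) ∩ L^×`
      have hmF : N k ∈ F := by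
        refine ⟨⟨(a : ideleGroup L) * k, hakW, ?_⟩, ideleGalNorm_mem_principalIdeles K L hk⟩
        rw [map_mul, hNa, one_mul]
      have hNrep : N (rep (N k)) = N k := hrep_N (N k) ⟨k, hk, rfl⟩
      -- `c := a k k_m⁻¹ ∈ C ∩ ker N`
      have hcA : (a : ideleGroup L) * k * (rep (N k))⁻¹ ∈ relNormOneIdeles K L := by
        rw [mem_relNormOneIdeles_iff, map_mul, map_mul, map_inv, hNa, one_mul, hNrep, mul_inv_cancel]
      have hcC : (a : ideleGroup L) * k * (rep (N k))⁻¹ ∈ C :=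
        Set.mem_biUnion hmF ⟨(a : ideleGroup L) * k, hakW, rfl⟩
      refine ⟨⟨_, hcA⟩, hcC, ?_⟩
      -- `c ≡ a` modulo `L^1`: `c⁻¹ a = k_m k⁻¹ ∈ L^× ∩ ker N`
      refine QuotientGroup.eq.mpr ?_
      rw [mem_relNormOneRat_iff]
      change ((a : ideleGroup L) * k * (rep (N k))⁻¹)⁻¹ * (a : ideleGroup L) ∈ principalIdeles L
      rw [show ((a : ideleGroup L) * k * (rep (N k))⁻¹)⁻¹ * (a : ideleGroup L) = rep (N k) * k⁻¹ by
        rw [mul_inv_rev, mul_inv_rev, inv_inv, mul_assoc, mul_assoc, inv_mul_cancel, mul_one]]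
      exact mul_mem (hrep_mem _) (inv_mem hk)
  refine ⟨?_⟩
  rw [← himg]
  exact hCA.image continuous_quot_mk

/-! ### The measure fields: Borel σ-algebra and the Haar probability measure `du` -/

/-- (Ported verbatim from the HodgeCMPerL package; no docstring in the source.) -/
instance measurableSpace_relNormOneQuot : MeasurableSpace (relNormOneIdeles K L ⧸ relNormOneRat K L) := borel _

/-- (Ported verbatim from the HodgeCMPerL package; no docstring in the source.) -/
instance borelSpace_relNormOneQuot : BorelSpace (relNormOneIdeles K L ⧸ relNormOneRat K L) := ⟨rfl⟩

example : LocallyCompactSpace (relNormOneIdeles K L ⧸ relNormOneRat K L) := inferInstance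

/-- The measure `du` on `[U(1)_{L/K}]` (PerL l. 264): Haar measure of the compact abelian group. -/
def haarRelNormOneQuot : Measure (relNormOneIdeles K L ⧸ relNormOneRat K L) := Measure.haar

/-- (Ported verbatim from the HodgeCMPerL package; no docstring in the source.) -/
instance isFiniteMeasure_haarRelNormOneQuot : IsFiniteMeasure (haarRelNormOneQuot K L) := by
  unfold haarRelNormOneQuot; infer_instance

/-- (Ported verbatim from the HodgeCMPerL package; no docstring in the source.) -/
instance isOpenPosMeasure_haarRelNormOneQuot : (haarRelNormOneQuot K L).IsOpenPosMeasure := by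
  unfold haarRelNormOneQuot; infer_instance

/-- (Ported verbatim from the HodgeCMPerL package; no docstring in the source.) -/
instance isMulLeftInvariant_haarRelNormOneQuot : (haarRelNormOneQuot K L).IsMulLeftInvariant := by
  unfold haarRelNormOneQuot; infer_instance

/-- (Ported verbatim from the HodgeCMPerL package; no docstring in the source.) -/
theorem map_mul_right_haarRelNormOneQuot (g : relNormOneIdeles K L ⧸ relNormOneRat K L) :
    Measure.map (· * g) (haarRelNormOneQuot K L) = haarRelNormOneQuot K L := by
  have h : (fun x : relNormOneIdeles K L ⧸ relNormOneRat K L => x * g) = fun x => g * x :=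
    funext fun x => mul_comm x g
  rw [h]
  exact map_mul_left_eq_self _ g

/-- (Ported verbatim from the HodgeCMPerL package; no docstring in the source.) -/
instance isMulRightInvariant_haarRelNormOneQuot : (haarRelNormOneQuot K L).IsMulRightInvariant :=
  ⟨map_mul_right_haarRelNormOneQuot K L⟩

end Torus

/-! ## § 3. Packaging: the group / measure fields of `SupplyBridgeA`, constructed -/

/-- The automorphic-quotient data of the route-(E) record `SupplyAdelic.SupplyBridgeA`, field for field
(`A = DS.A₁`, `instA instT instTG instT2`, `rat`, `instD`, `instQ`, `instM instB`, `ν`, `instF instO instR`), as a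
stand-alone record — so that "these fields are constructible for the genuine `U(W_j)`" is one definition,
`relNormOneTorusDatum`, rather than a list of instances. -/
structure AutomorphicTorusDatum where
  /-- `U(W_j)(𝔸)` -/
  A : Type
  [instA : CommGroup A]
  [instT : TopologicalSpace A]
  [instTG : IsTopologicalGroup A]
  [instT2 : T2Space A]
  [instLC : LocallyCompactSpace A]
  /-- `U(W_j)(L₀)` -/
  rat : Subgroup A
  [instD : DiscreteTopology rat]
  [instQ : CompactSpace (A ⧸ rat)]
  [instQT2 : T2Space (A ⧸ rat)]
  [instM : MeasurableSpace (A ⧸ rat)]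
  [instB : BorelSpace (A ⧸ rat)]
  /-- `du` -/
  ν : Measure (A ⧸ rat)
  [instF : IsFiniteMeasure ν]
  [instO : ν.IsOpenPosMeasure]
  [instR : ν.IsMulRightInvariant]


-- port_pkg: scope closed for this part
end NumberField
end
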